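import Literature.NumberTheory.EllipticCurves.TwoDescentLocalTwo
import HarnessLib

/-!
# Characters of `ℚ*/ℚ*²` on `S`-supported classes, and their values at small primes

Glue for explicit complete `2`-descents over `ℚ` (Silverman, *AEC*, Prop. X.1.4, Example X.1.5:
"`b ∈ ℚ(S, 2)` is represented by `±∏_{p ∈ S} p^{ε_p}`"). For a finite set of primes `S` and a
non-zero rational `z` whose valuations at the primes outside `S` are even, unique factorisation
gives `z = ± ∏_{p ∈ S} p^{v_p(z)} · r²`, hence for every character `χ : ℚ*/ℚ*² → ℤ/2`

* `char_sqClass_eq_sum` — `χ[z] = sign(z) χ[-1] + Σ_{p ∈ S} v_p(z) χ[p]` (in `ℤ/2`).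

Together with the VALUES of the local characters of the tree (`signHom`, `parityHom p`
(`KramerTwoDescentSquares.lean`), `qrHom p` (`TwoDescentLocalOdd.lean`), `chi4Hom`, `chi8Hom`
(`TwoDescentLocalTwo.lean`)) at `-1` and at the primes `2, 3, 5, 41, 73` (`chi4_neg_one`, …,
`qrBit_five_seventyThree`), this turns the local conditions of a `2`-descent into linear
conditions on the sign/parity coordinates of the descent classes. Everything is proved.

## References

* J. H. Silverman, *The Arithmetic of Elliptic Curves*, 2nd ed., GTM 106 (2009), Prop. X.1.4,
  Example X.1.5. [SilvermanAEC2009]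
-/

noncomputable section

open scoped Classical

open WeierstrassCurve.Affine

namespace Literature.NumberTheory.EllipticCurves.TwoDescentLocal

open Literature.NumberTheory.EllipticCurves.KramerTwoDescent

/-! ### Square classes of inverses and powers -/

/-- `sqClass a⁻¹ = sqClass a` (`a⁻¹ = a · (a⁻¹)²`). [folklore] -/
theorem sqClass_inv (a : ℚ) : sqClass a⁻¹ = sqClass a := by
  by_cases ha : a = 0
  · rw [ha, inv_zero]
  · have h : a⁻¹ = a * (a⁻¹ * a⁻¹) := by field_simp
    rw [h, sqClass_mul ha (mul_ne_zero (inv_ne_zero ha) (inv_ne_zero ha)), sqClass_mul_self,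
      SqUnits.mul_one]

/-- `sqClass (a ^ n) = sqClass a ^ n` for `a ≠ 0`, `n : ℕ`. [folklore] -/
theorem sqClass_pow {a : ℚ} (ha : a ≠ 0) (n : ℕ) : sqClass (a ^ n) = sqClass a ^ n := by
  induction n with
  | zero => rw [pow_zero, pow_zero, show (1 : ℚ) = 1 * 1 from (mul_one 1).symm, sqClass_mul_self]
  | succ n ih => rw [pow_succ, pow_succ, sqClass_mul (pow_ne_zero n ha) ha, ih]

/-- `sqClass (a ^ n) = sqClass a ^ n` for `a ≠ 0`, `n : ℤ`. [folklore] -/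
theorem sqClass_zpow {a : ℚ} (ha : a ≠ 0) (n : ℤ) : sqClass (a ^ n) = sqClass a ^ n := by
  obtain ⟨m, rfl | rfl⟩ := Int.eq_nat_or_neg n
  · rw [zpow_natCast, zpow_natCast, sqClass_pow ha]
  · rw [zpow_neg, zpow_natCast, zpow_neg, zpow_natCast, sqClass_inv, sqClass_pow ha,
      SqUnits.inv_eq_self]

/-- A character of `ℚ*/ℚ*²` on an integer power: `χ[a^n] = n · χ[a]`. [folklore] -/
theorem char_sqClass_zpow (χ : Additive (SqUnits ℚ) →+ ZMod 2) {a : ℚ} (ha : a ≠ 0) (n : ℤ) :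
    χ (Additive.ofMul (sqClass (a ^ n))) = (n : ZMod 2) * χ (Additive.ofMul (sqClass a)) := by
  rw [sqClass_zpow ha, ofMul_zpow, map_zsmul, zsmul_eq_mul]

/-- The sign of a non-zero rational as a square class: `sqClass z = sqClass (±1) · (…)`; here
the part `χ[sign] = signBit z · χ[-1]`. [folklore] -/
theorem char_sqClass_sign (χ : Additive (SqUnits ℚ) →+ ZMod 2) (z : ℚ) :
    χ (Additive.ofMul (sqClass (if z < 0 then (-1 : ℚ) else 1))) =
      signBit z * χ (Additive.ofMul (sqClass (-1 : ℚ))) := by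
  by_cases hz : z < 0
  · rw [if_pos hz, signBit, if_pos hz, one_mul]
  · rw [if_neg hz, signBit, if_neg hz, zero_mul,
      show (1 : ℚ) = 1 * 1 from (mul_one 1).symm, sqClass_mul_self, ofMul_one, map_zero]

/-- **Characters on `S`-supported classes.** Let `S` be a finite set of primes and `z ≠ 0` a
rational with `v_q(z)` even for every prime `q ∉ S`. Then for every character
`χ : ℚ*/ℚ*² → ℤ/2`, `χ[z] = signBit z · χ[-1] + Σ_{p ∈ S} parityBit p z · χ[p]`
(unique factorisation: `z = ± ∏_{p∈S} p^{v_p(z)} · r²`; Silverman AEC Example X.1.5, "`b` is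
represented by `±∏ p^{ε_p}`"). [cite: SilvermanAEC2009, Example X.1.5] -/
theorem char_sqClass_eq_sum (χ : Additive (SqUnits ℚ) →+ ZMod 2) (S : Finset ℕ)
    (hS : ∀ q ∈ S, q.Prime) {z : ℚ} (hz : z ≠ 0)
    (h : ∀ q : ℕ, q.Prime → q ∉ S → Even (padicValRat q z)) :
    χ (Additive.ofMul (sqClass z)) =
      signBit z * χ (Additive.ofMul (sqClass (-1 : ℚ))) +
        ∑ p ∈ S, parityBit p z * χ (Additive.ofMul (sqClass (p : ℚ))) := by
  induction S using Finset.induction_on generalizing z with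
  | empty =>
    -- all valuations even: `|z| = r²`
    rw [Finset.sum_empty, add_zero]
    have hpos : 0 < |z| := abs_pos.mpr hz
    obtain ⟨r, hr⟩ := exists_sq_of_even_padicValRat hpos fun p hp => by
      rcases abs_choice z with h' | h' <;> rw [h']
      · exact h p hp (Finset.notMem_empty p)
      · rw [padicValRat.neg]; exact h p hp (Finset.notMem_empty p)
    have hr0 : r ≠ 0 := by rintro rfl; rw [zero_pow two_ne_zero] at hr; exact hpos.ne' hr
    have hzr : z = (if z < 0 then (-1 : ℚ) else 1) * r ^ 2 := by
      by_cases hneg : z < 0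
      · rw [if_pos hneg, ← hr, abs_of_neg hneg]; ring
      · rw [if_neg hneg, ← hr, abs_of_nonneg (not_lt.mp hneg)]; ring
    rw [hzr, sqClass_mul (by split_ifs <;> norm_num) (pow_ne_zero 2 hr0), sqClass_sq,
      SqUnits.mul_one, ← hzr, char_sqClass_sign]
  | insert p S hp ih =>
    have hSp : ∀ q ∈ S, q.Prime := fun q hq => hS q (Finset.mem_insert_of_mem hq)
    haveI : Fact p.Prime := ⟨hS p (Finset.mem_insert_self p S)⟩
    have hp0 : (p : ℚ) ≠ 0 := Nat.cast_ne_zero.mpr (Fact.out : p.Prime).ne_zero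
    -- `z' = z / p^{v_p z}` has even valuations outside `S`
    set z' : ℚ := z * (p : ℚ) ^ (-padicValRat p z) with hz'
    have hz'0 : z' ≠ 0 := mul_ne_zero hz (zpow_ne_zero _ hp0)
    have hval : ∀ q : ℕ, q.Prime → padicValRat q z' = if q = p then 0 else padicValRat q z := by
      intro q hq
      haveI : Fact q.Prime := ⟨hq⟩
      rw [hz', padicValRat.mul hz (zpow_ne_zero _ hp0), padicValRat.zpow, padicValRat.of_nat]
      by_cases hqp : q = p
      · subst hqp; rw [padicValNat_self, if_pos rfl]; push_cast; ring
      · rw [padicValNat_primes hqp, if_neg hqp]; push_cast; ring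
    have h' : ∀ q : ℕ, q.Prime → q ∉ S → Even (padicValRat q z') := by
      intro q hq hqS
      rw [hval q hq]
      by_cases hqp : q = p
      · rw [if_pos hqp]; exact ⟨0, rfl⟩
      · rw [if_neg hqp]
        exact h q hq (by rw [Finset.mem_insert]; exact not_or.mpr ⟨hqp, hqS⟩)
    have key := ih hSp hz'0 h'
    -- `z = z' · p^{v_p z}`
    have hzz : z = z' * (p : ℚ) ^ padicValRat p z := by
      rw [hz', mul_assoc, ← zpow_add₀ hp0, neg_add_cancel, zpow_zero, mul_one]
    have hsign : signBit z' = signBit z := by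
      have hpow : 0 < (p : ℚ) ^ (-padicValRat p z) := zpow_pos (by exact_mod_cast (Fact.out : p.Prime).pos) _
      rw [signBit, signBit, hz']
      by_cases hneg : z < 0
      · rw [if_pos (mul_neg_of_neg_of_pos hneg hpow), if_pos hneg]
      · rw [if_neg (not_lt.mpr (mul_nonneg (not_lt.mp hneg) hpow.le)), if_neg hneg]
    have hpar : ∀ q ∈ S, parityBit q z' = parityBit q z := by
      intro q hq
      have hqp : q ≠ p := fun hqp => hp (hqp ▸ hq)
      rw [parityBit, parityBit, hval q (hSp q hq), if_neg hqp]
    have hL : χ (Additive.ofMul (sqClass z)) = χ (Additive.ofMul (sqClass z')) +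
        (padicValRat p z : ZMod 2) * χ (Additive.ofMul (sqClass (p : ℚ))) := by
      conv_lhs => rw [hzz]
      rw [sqClass_mul hz'0 (zpow_ne_zero _ hp0), ofMul_mul, map_add, char_sqClass_zpow χ hp0]
    rw [hL, key, Finset.sum_insert hp, hsign, Finset.sum_congr rfl fun q hq => by rw [hpar q hq],
      parityBit]
    ring

/-! ### Values of the local characters at `-1` and at small primes -/

section Values

/-- `5` is prime (instance for `res 5`, `qrBit 5`, `parityHom 5`). [folklore] -/
instance fact_prime_five : Fact (Nat.Prime 5) := ⟨Nat.prime_five⟩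

/-- `signBit` at `-1` and at the naturals. [folklore] -/
theorem signBit_values : signBit (-1 : ℚ) = 1 ∧ ∀ n : ℕ, signBit (n : ℚ) = 0 :=
  ⟨if_pos (by norm_num), fun n => if_neg (not_lt.mpr n.cast_nonneg)⟩

/-- `parityBit p (-1) = 0`, `parityBit p p = 1`, `parityBit p q = 0` for primes `q ≠ p`.
[folklore] -/
theorem parityBit_values (p : ℕ) [hp : Fact p.Prime] :
    parityBit p (-1 : ℚ) = 0 ∧ parityBit p (p : ℚ) = 1 ∧
      ∀ q : ℕ, q.Prime → q ≠ p → parityBit p (q : ℚ) = 0 := by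
  refine ⟨by rw [parityBit, padicValRat.neg, padicValRat.one, Int.cast_zero], ?_, ?_⟩
  · rw [parityBit, padicValRat.self hp.out.one_lt, Int.cast_one]
  · intro q hq hqp
    haveI : Fact q.Prime := ⟨hq⟩
    rw [parityBit, padicValRat.of_nat, padicValNat_primes (Ne.symm hqp)]
    rfl

/-- `res8` of small odd integers. [folklore] -/
theorem res8_values :
    res8 (-1 : ℚ) = 7 ∧ res8 (2 : ℚ) = 1 ∧ res8 (3 : ℚ) = 3 ∧ res8 (5 : ℚ) = 5 ∧
      res8 (41 : ℚ) = 1 ∧ res8 (73 : ℚ) = 1 := by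
  refine ⟨?_, ?_, ?_, ?_, ?_, ?_⟩
  · rw [show (-1 : ℚ) = ((-1 : ℤ) : ℚ) by norm_num, res8_intCast (by decide)]; decide
  · rw [show (2 : ℚ) = (2 : ℚ) ^ (1 : ℤ) * 1 by norm_num, res8_two_zpow_mul 1 one_ne_zero,
      show (1 : ℚ) = ((1 : ℤ) : ℚ) by norm_num, res8_intCast (by decide)]; decide
  · rw [show (3 : ℚ) = ((3 : ℤ) : ℚ) by norm_num, res8_intCast (by decide)]; decide
  · rw [show (5 : ℚ) = ((5 : ℤ) : ℚ) by norm_num, res8_intCast (by decide)]; decide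
  · rw [show (41 : ℚ) = ((41 : ℤ) : ℚ) by norm_num, res8_intCast (by decide)]; decide
  · rw [show (73 : ℚ) = ((73 : ℤ) : ℚ) by norm_num, res8_intCast (by decide)]; decide

/-- Values of `chi4`: `-1 ↦ 1`, `2 ↦ 0`, `3 ↦ 1`, `5 ↦ 0`, `41 ↦ 0`, `73 ↦ 0`. [folklore] -/
theorem chi4_values :
    chi4 (-1 : ℚ) = 1 ∧ chi4 (2 : ℚ) = 0 ∧ chi4 (3 : ℚ) = 1 ∧ chi4 (5 : ℚ) = 0 ∧
      chi4 (41 : ℚ) = 0 ∧ chi4 (73 : ℚ) = 0 := by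
  obtain ⟨h1, h2, h3, h5, h41, h73⟩ := res8_values
  simp only [chi4, h1, h2, h3, h5, h41, h73]
  decide

/-- Values of `chi8`: `-1 ↦ 0`, `2 ↦ 0`, `3 ↦ 1`, `5 ↦ 1`, `41 ↦ 0`, `73 ↦ 0`. [folklore] -/
theorem chi8_values :
    chi8 (-1 : ℚ) = 0 ∧ chi8 (2 : ℚ) = 0 ∧ chi8 (3 : ℚ) = 1 ∧ chi8 (5 : ℚ) = 1 ∧
      chi8 (41 : ℚ) = 0 ∧ chi8 (73 : ℚ) = 0 := by
  obtain ⟨h1, h2, h3, h5, h41, h73⟩ := res8_values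
  simp only [chi8, h1, h2, h3, h5, h41, h73]
  decide

/-- The residues at `3` of `-1, 2, 5, 41, 73` (all `≡ 2 (mod 3)`) and of `3` (`1`). [folklore] -/
theorem res_three_values :
    res 3 (-1 : ℚ) = 2 ∧ res 3 (2 : ℚ) = 2 ∧ res 3 (3 : ℚ) = 1 ∧ res 3 (5 : ℚ) = 2 ∧
      res 3 (41 : ℚ) = 2 ∧ res 3 (73 : ℚ) = 1 := by
  have hv : ∀ z : ℤ, ¬ (3 : ℤ) ∣ z → res 3 (z : ℚ) = (z : ZMod 3) := fun z hz => by
    rw [res_of_eq_zero 3 (padicValRat_intCast_eq_zero (by exact_mod_cast hz)), Rat.cast_intCast]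
  refine ⟨?_, ?_, ?_, ?_, ?_, ?_⟩
  · rw [show (-1 : ℚ) = ((-1 : ℤ) : ℚ) by norm_num, hv _ (by decide)]; decide
  · rw [show (2 : ℚ) = ((2 : ℤ) : ℚ) by norm_num, hv _ (by decide)]; decide
  · show (((3 : ℚ) / (3 : ℚ) ^ padicValRat 3 (3 : ℚ) : ℚ) : ZMod 3) = 1
    rw [show (3 : ℚ) = ((3 : ℕ) : ℚ) by norm_num, padicValRat.self (by norm_num), zpow_one,
      div_self (by norm_num), Rat.cast_one]
  · rw [show (5 : ℚ) = ((5 : ℤ) : ℚ) by norm_num, hv _ (by decide)]; decide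
  · rw [show (41 : ℚ) = ((41 : ℤ) : ℚ) by norm_num, hv _ (by decide)]; decide
  · rw [show (73 : ℚ) = ((73 : ℤ) : ℚ) by norm_num, hv _ (by decide)]; decide

/-- The residues at `5` of `-1, 2, 3, 41, 73` and of `5`. [folklore] -/
theorem res_five_values :
    res 5 (-1 : ℚ) = 4 ∧ res 5 (2 : ℚ) = 2 ∧ res 5 (3 : ℚ) = 3 ∧ res 5 (5 : ℚ) = 1 ∧
      res 5 (41 : ℚ) = 1 ∧ res 5 (73 : ℚ) = 3 := by
  have hv : ∀ z : ℤ, ¬ (5 : ℤ) ∣ z → res 5 (z : ℚ) = (z : ZMod 5) := fun z hz => by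
    rw [res_of_eq_zero 5 (padicValRat_intCast_eq_zero (by exact_mod_cast hz)), Rat.cast_intCast]
  refine ⟨?_, ?_, ?_, ?_, ?_, ?_⟩
  · rw [show (-1 : ℚ) = ((-1 : ℤ) : ℚ) by norm_num, hv _ (by decide)]; decide
  · rw [show (2 : ℚ) = ((2 : ℤ) : ℚ) by norm_num, hv _ (by decide)]; decide
  · rw [show (3 : ℚ) = ((3 : ℤ) : ℚ) by norm_num, hv _ (by decide)]; decide
  · show (((5 : ℚ) / (5 : ℚ) ^ padicValRat 5 (5 : ℚ) : ℚ) : ZMod 5) = 1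
    rw [show (5 : ℚ) = ((5 : ℕ) : ℚ) by norm_num, padicValRat.self (by norm_num), zpow_one,
      div_self (by norm_num), Rat.cast_one]
  · rw [show (41 : ℚ) = ((41 : ℤ) : ℚ) by norm_num, hv _ (by decide)]; decide
  · rw [show (73 : ℚ) = ((73 : ℤ) : ℚ) by norm_num, hv _ (by decide)]; decide

/-- The squares of `𝔽₃` and `𝔽₅` needed: `2` is a non-square mod `3`; `2, 3` are non-squares and
`4` is a square mod `5`. [folklore] -/
theorem isSquare_values :
    ¬ IsSquare (2 : ZMod 3) ∧ ¬ IsSquare (2 : ZMod 5) ∧ ¬ IsSquare (3 : ZMod 5) ∧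
      IsSquare (4 : ZMod 5) ∧ IsSquare (1 : ZMod 3) ∧ IsSquare (1 : ZMod 5) := by
  refine ⟨?_, ?_, ?_, ⟨2, by decide⟩, ⟨1, by decide⟩, ⟨1, by decide⟩⟩
  · rintro ⟨r, hr⟩; fin_cases r <;> revert hr <;> decide
  · rintro ⟨r, hr⟩; fin_cases r <;> revert hr <;> decide
  · rintro ⟨r, hr⟩; fin_cases r <;> revert hr <;> decide

/-- `qrBit p a` from the residue: non-square residue gives `1`. [folklore] -/
theorem qrBit_eq_one_of_not_isSquare {p : ℕ} [Fact p.Prime] {a : ℚ} (h : ¬ IsSquare (res p a)) :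
    qrBit p a = 1 := by
  rw [qrBit, if_pos (quadraticChar_neg_one_iff_not_isSquare.mpr h)]

/-- `qrBit p a` from the residue: square residue gives `0`. [folklore] -/
theorem qrBit_eq_zero_of_isSquare {p : ℕ} [Fact p.Prime] {a : ℚ} (h : IsSquare (res p a)) :
    qrBit p a = 0 :=
  (qrBit_eq_zero_iff p a).mpr h

/-- Values of `qrBit 3`: `-1, 2, 5, 41 ↦ 1`; `3, 73 ↦ 0`. [folklore] -/
theorem qrBit_three_values :
    qrBit 3 (-1 : ℚ) = 1 ∧ qrBit 3 (2 : ℚ) = 1 ∧ qrBit 3 (3 : ℚ) = 0 ∧ qrBit 3 (5 : ℚ) = 1 ∧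
      qrBit 3 (41 : ℚ) = 1 ∧ qrBit 3 (73 : ℚ) = 0 := by
  obtain ⟨h1, h2, h3, h5, h41, h73⟩ := res_three_values
  obtain ⟨n3, -, -, -, s13, -⟩ := isSquare_values
  exact ⟨qrBit_eq_one_of_not_isSquare (by rw [h1]; exact n3),
    qrBit_eq_one_of_not_isSquare (by rw [h2]; exact n3),
    qrBit_eq_zero_of_isSquare (by rw [h3]; exact s13),
    qrBit_eq_one_of_not_isSquare (by rw [h5]; exact n3),
    qrBit_eq_one_of_not_isSquare (by rw [h41]; exact n3),
    qrBit_eq_zero_of_isSquare (by rw [h73]; exact s13)⟩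

/-- Values of `qrBit 5`: `-1 ↦ 0`; `2, 3, 73 ↦ 1`; `5, 41 ↦ 0`. [folklore] -/
theorem qrBit_five_values :
    qrBit 5 (-1 : ℚ) = 0 ∧ qrBit 5 (2 : ℚ) = 1 ∧ qrBit 5 (3 : ℚ) = 1 ∧ qrBit 5 (5 : ℚ) = 0 ∧
      qrBit 5 (41 : ℚ) = 0 ∧ qrBit 5 (73 : ℚ) = 1 := by
  obtain ⟨h1, h2, h3, h5, h41, h73⟩ := res_five_values
  obtain ⟨-, n2, n3, s4, -, s15⟩ := isSquare_values
  exact ⟨qrBit_eq_zero_of_isSquare (by rw [h1]; exact s4),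
    qrBit_eq_one_of_not_isSquare (by rw [h2]; exact n2),
    qrBit_eq_one_of_not_isSquare (by rw [h3]; exact n3),
    qrBit_eq_zero_of_isSquare (by rw [h5]; exact s15),
    qrBit_eq_zero_of_isSquare (by rw [h41]; exact s15),
    qrBit_eq_one_of_not_isSquare (by rw [h73]; exact n3)⟩

end Values

end Literature.NumberTheory.EllipticCurves.TwoDescentLocal

end
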